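import Summits.QuantumFields.YangMills.Theorems.UnitScaleTiltProp7AliasSumBernstein
import HarnessLib

/-!
# Route `UnitScaleTilt`, crux K1 «MinimiserStabilityRegPr» (stmt-QuantumFields-19200), route-R E′ growth side, line HKGK-ANALYTIC — BERNSTEIN ONE ORDER UP for the
# curl-minimal interpolant: `Σ_l W_l ≤ C_B↑·Σ_l W_l∕Δ(p′+l)` per reduced momentum, hence `‖f‖² ≤ C_B↑·re⟪f, Δ⁻¹f⟫` for `f = ((Q_k)ᴴB)_κ` (η-units), i.e. in lattice units
# `ℓ²·‖Δu‖² ≤ C_B↑·‖∇u‖²` for `u = Δ⁻¹f` — the flat leading order of the CURRENT row (J-ROW★): at an R2-critical background the lattice current `J = D^*_WF_W` is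
# coarse-structured (`J = Q_W^*λ`), so its commutator energy is `ℓ⁻²`-dominated by the curvature-commutator energy

Cell `ym3-torus`, width seat `ym-ust-19200-w4` (gen 7).  Sequel to ✓ `Prop7AliasSumBernstein` (exponents `(1,2)`: `‖∇u‖² ≤ C_Bℓ⁻²‖u‖²`); this file is the exponent pair `(0,1)`.
Located need (bus 2026-08-29 01:0xZ, after px4 g4's ‼ LOCATE-HLAP): booking the current commutator `[(D^*F)(s), m]` of the (H) Laplacian row by two plaquette commutators
(✓ `Prop7CurrentConjugationDefect`) is `ℓ²`-lossy; the k-uniform mechanism is criticality — `J` coarse ⇒ `Σ‖[J, m]‖² = ‖Δ(A×m)‖² ≤ C_B↑ℓ⁻²‖∇(A×m)‖² = C_B↑ℓ⁻²Σ_p‖[hol_p, m]‖²` at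
leading order (numerically ρ_J2′: 10.7–45.2 at seeds vs 0.76 at the constrained critical point, ℓ = 3).  THEOREMS ONLY (0 `def`, 0 `sorry`); `--supports stmt-QuantumFields-19200`,
count-neutral.  YM₃ on T³ is a ladder rung (R3), not the Clay problem; nothing here claims the J-row, hRes, S3, E′, a stub, the crux, d = 4 or the mass gap.

WHAT IS PROVED (ns `…Theorems.Prop7AliasSumBernsteinUp`; letters of ✓ `Prop7AliasSumBernstein`).
* §1 ★★ `alias_sum_le_of_weights_up` — `Σ_l W_l ≤ (dπ² + dπ²∕w₀)·Σ_l W_l∕Δ_l` for `0 ≤ W_l ≤ Ur_l` (`l ≠ 0`), `W_0 ≥ w₀ > 0` (`p′ ≠ 0`, `|p′_μ| ≤ π`; η-units);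
  ★★★ `alias_sum_tent_le_up` — the box–box–tent weights `Ur·uFactorr(l_μ)`: constant `C_B↑ = dπ²·(1 + (π²∕4)^{d+1})` (d = 3: ≈ 1.13·10³; crude, ABSOLUTE).
* §2 ★ `sum_le_sum_div_lsym_of_fibrewise`, ★★ `sum_le_sum_div_lsym_of_tent_fibres` — fibre-to-torus.
* §3 ★★★ `bernstein_up_QvOp_adjoint` (momentum form) ∕ ★★★ `bernstein_up_QvOp_adjoint_pos` — for `f = ((Q_k)ᴴB)_κ`, `Σ_yB(y,κ) = 0`:  `Σ_x‖f x‖² ≤ C_B↑·re⟪f, Δ⁻¹f⟫` (η-units,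
  `Δ⁻¹ = LapSinv (fine n M) n`); lattice reading: `ℓ²·‖Δu‖² ≤ C_B↑·‖∇u‖²` for the interpolant `u = Δ⁻¹f`, `ℓ = n = L^k`.
HONEST SCOPE.  Trigonometric-sum inequalities + Plancherel; the identification «`J = 𝒦A` coarse at criticality» and the curved∕local passage are NOT here (LOCATE v2 (R-crit-loc)).

References: T. Bałaban, CMP 95 (1984) 17–40 [Balaban1984PropagatorsI] ((1.18) p.20, (1.31)–(1.36) pp.23–24); CMP 99 (1985) 75–102 [Balaban1985RegularSpaces] ((1.9) p.77);
CMP 102 (1985) 277–309 [Balaban1985Variational] (Prop. 7 p.299).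
-/

set_option autoImplicit false

noncomputable section

open scoped BigOperators Matrix ComplexConjugate
open Finset

namespace Summit.QuantumFields.YangMills.Theorems.Prop7AliasSumBernsteinUp

open Literature.MathematicalPhysics.QuantumFieldTheory.Balaban1983to89
open B4Strip B5Prop11Fiber B5Prop11Leaves B5Prop11Plancherel B5Action121 B5Block118 B5LaplaceInverse B5LaplaceSpectral
open B5Momentum130 B5Momentum133 B5Eq135Momentum
open Summit.QuantumFields.YangMills.Theorems.Prop7AliasSumBernstein (sum_div_lsym_le_of_fibrewise)

variable {d : ℕ} (n : ℕ) [NeZero n]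

/-! ## §1 The alias inequality one order up -/

/-- ★★ **WEIGHTED ALIAS INEQUALITY, ONE ORDER UP**: at `p′ = s ≠ 0`, `|s_μ| ≤ π`, for weights `0 ≤ W_l ≤ Ur_l` (`l ≠ 0`), `W_0 ≥ w₀ > 0`:
`Σ_l W_l ≤ (dπ² + dπ²∕w₀)·Σ_l W_l∕Δ(p′+l)` (η-units: `Δ(p′) ≤ dπ²`, `Σ_{l≠0}Ur_l ≤ 1`). [cite: Balaban1984PropagatorsI, (1.31)-(1.36) pp.23-24] -/
theorem alias_sum_le_of_weights_up (hn : 1 ≤ n) (s : Fin d → ℝ) (hs : ∀ μ, |s μ| ≤ Real.pi) (hs0 : s ≠ 0)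
    (W : (Fin d → Fin n) → ℝ) (hW0 : ∀ k, 0 ≤ W k) (hWle : ∀ k, k ≠ (fun _ => (0 : Fin n)) → W k ≤ Ur n k s)
    {w₀ : ℝ} (hw₀ : 0 < w₀) (hW₀ : w₀ ≤ W (fun _ => (0 : Fin n))) :
    ∑ k : Fin d → Fin n, W k
      ≤ (d * Real.pi ^ 2 + d * Real.pi ^ 2 / w₀) * ∑ k : Fin d → Fin n, W k / DeltaXir n 0 (shiftr n k s) := by
  set k0 : Fin d → Fin n := fun _ => (0 : Fin n) with hk0
  obtain ⟨μ0, hμ0⟩ : ∃ μ, s μ ≠ 0 := Function.ne_iff.mp hs0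
  have hpi : 0 < Real.pi := Real.pi_pos
  have hD0 : DeltaXir n 0 (shiftr n k0 s) = DeltaXir n 0 s := by rw [hk0, shiftr_zero]
  have hD0pos : 0 < DeltaXir n 0 s := DeltaXir_pos n hn s hs μ0 hμ0
  have hD0le : DeltaXir n 0 s ≤ d * Real.pi ^ 2 := by
    unfold DeltaXir
    rw [add_zero]
    calc ∑ μ, Sxir n (s μ) ≤ ∑ _μ : Fin d, Real.pi ^ 2 := Finset.sum_le_sum fun μ _ =>
            (Sxir_le n (s μ)).trans (by have := hs μ; nlinarith [abs_le.mp this, sq_abs (s μ)])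
      _ = d * Real.pi ^ 2 := by rw [Finset.sum_const, Finset.card_univ, Fintype.card_fin, nsmul_eq_mul]
  have hdpos : 0 < (d : ℝ) * Real.pi ^ 2 := lt_of_lt_of_le hD0pos hD0le
  have hUnn : ∀ k, 0 ≤ Ur n k s := fun k => Ur_nonneg n k s
  have hDnn : ∀ k, 0 ≤ DeltaXir n 0 (shiftr n k s) := fun k => DeltaXir_nonneg n 0 le_rfl _
  have hS0 : ∑ k ∈ univ.erase k0, Ur n k s ≤ 1 := S0_le_one n hn s hs
  -- the principal term of the right-hand side
  set T : ℝ := W k0 / DeltaXir n 0 s with hT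
  have hTge : w₀ / (d * Real.pi ^ 2) ≤ T := by
    rw [hT]; exact div_le_div₀ (hW0 k0) hW₀ hD0pos hD0le
  -- (i) the principal alias on the left: `W₀ = Δ₀·T ≤ dπ²·T`
  have h0 : W k0 ≤ d * Real.pi ^ 2 * T := by
    have e : W k0 = DeltaXir n 0 s * T := by rw [hT]; field_simp
    rw [e]
    have hT0 : 0 ≤ T := by rw [hT]; exact div_nonneg (hW0 _) hD0pos.le
    exact mul_le_mul_of_nonneg_right hD0le hT0
  -- (ii) the aliases: `Σ_{l≠0} W_l ≤ 1 ≤ (dπ²∕w₀)·T`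
  have h1 : ∑ k ∈ univ.erase k0, W k ≤ 1 :=
    (Finset.sum_le_sum fun k hk => hWle k (Finset.ne_of_mem_erase hk)).trans hS0
  have h1' : (1 : ℝ) ≤ d * Real.pi ^ 2 / w₀ * T := by
    have e : d * Real.pi ^ 2 / w₀ * (w₀ / (d * Real.pi ^ 2)) = (1 : ℝ) := by
      rw [div_mul_div_comm, div_eq_one_iff_eq (mul_pos hw₀ hdpos).ne']
      ring
    rw [← e]
    exact mul_le_mul_of_nonneg_left hTge (by positivity)
  -- (iii) the right-hand side dominates its principal term
  have hR : T ≤ ∑ k : Fin d → Fin n, W k / DeltaXir n 0 (shiftr n k s) := by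
    rw [hT, ← hD0]
    exact Finset.single_le_sum (f := fun k => W k / DeltaXir n 0 (shiftr n k s))
      (fun k _ => div_nonneg (hW0 k) (hDnn k)) (Finset.mem_univ k0)
  rw [← Finset.add_sum_erase _ _ (Finset.mem_univ k0)]
  have hC0 : 0 ≤ (d * Real.pi ^ 2 + d * Real.pi ^ 2 / w₀ : ℝ) := by positivity
  calc W k0 + ∑ k ∈ univ.erase k0, W k ≤ d * Real.pi ^ 2 * T + d * Real.pi ^ 2 / w₀ * T := add_le_add h0 (h1.trans h1')
    _ = (d * Real.pi ^ 2 + d * Real.pi ^ 2 / w₀) * T := by ring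
    _ ≤ (d * Real.pi ^ 2 + d * Real.pi ^ 2 / w₀) * ∑ k : Fin d → Fin n, W k / DeltaXir n 0 (shiftr n k s) :=
        mul_le_mul_of_nonneg_left hR hC0

/-- ★★★ **ONE ORDER UP FOR THE BOX–BOX–TENT WEIGHTS**: `Σ_l Ur·uFactorr(l_μ) ≤ dπ²·(1 + (π²∕4)^{d+1})·Σ_l Ur·uFactorr(l_μ)∕Δ(p′+l)` at every `p′ ≠ 0`.
[cite: Balaban1984PropagatorsI, (1.31)-(1.36) pp.23-24; Balaban1985Variational, (0.4) p.278] -/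
theorem alias_sum_tent_le_up (hn : 1 ≤ n) (s : Fin d → ℝ) (hs : ∀ μ, |s μ| ≤ Real.pi) (hs0 : s ≠ 0) (μ : Fin d) :
    ∑ k : Fin d → Fin n, Ur n k s * uFactorr n (k μ : ℕ) (s μ)
      ≤ (d * Real.pi ^ 2 * (1 + (Real.pi ^ 2 / 4) ^ (d + 1)))
          * ∑ k : Fin d → Fin n, Ur n k s * uFactorr n (k μ : ℕ) (s μ) / DeltaXir n 0 (shiftr n k s) := by
  have hpi : 0 < Real.pi := Real.pi_pos
  have hw₀ : (0 : ℝ) < (4 / Real.pi ^ 2) ^ (d + 1) := by positivity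
  have hW0 : ∀ k : Fin d → Fin n, 0 ≤ Ur n k s * uFactorr n (k μ : ℕ) (s μ) := fun k =>
    mul_nonneg (Ur_nonneg n k s) (uFactorr_nonneg n _ _)
  have hWle : ∀ k : Fin d → Fin n, k ≠ (fun _ => (0 : Fin n)) → Ur n k s * uFactorr n (k μ : ℕ) (s μ) ≤ Ur n k s := fun k _ =>
    mul_le_of_le_one_right (Ur_nonneg n k s) (uFactorr_le_one n hn _ _)
  have hW₀ : (4 / Real.pi ^ 2) ^ (d + 1) ≤ Ur n (fun _ => (0 : Fin n)) s * uFactorr n (((fun _ => (0 : Fin n)) μ : Fin n) : ℕ) (s μ) := by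
    rw [pow_succ]
    exact mul_le_mul (Ur_zero_ge n hn s hs) (by simpa using uFactorr_zero_ge n hn (s μ) (hs μ)) (by positivity) (Ur_nonneg n _ s)
  have h := alias_sum_le_of_weights_up n hn s hs hs0 (fun k => Ur n k s * uFactorr n (k μ : ℕ) (s μ)) hW0 hWle hw₀ hW₀
  have hC : (d * Real.pi ^ 2 + d * Real.pi ^ 2 / (4 / Real.pi ^ 2) ^ (d + 1) : ℝ) = d * Real.pi ^ 2 * (1 + (Real.pi ^ 2 / 4) ^ (d + 1)) := by
    have e : (4 / Real.pi ^ 2 : ℝ) ^ (d + 1) = ((Real.pi ^ 2 / 4) ^ (d + 1))⁻¹ := by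
      rw [← inv_pow]; congr 1; field_simp
    rw [e, div_inv_eq_mul]
    ring
  rw [hC] at h
  exact h

/-! ## §2 Fibre-to-torus -/

section Torus

variable (M : Fin d → ℕ) [hM : ∀ μ, NeZero (M μ)]

/-- ★ **FIBRE-TO-TORUS, one order up**: a non-negative momentum density vanishing on the zero fibre and obeying `Σ_l g ≤ C·Σ_l g∕Δ` fibrewise obeys it globally. [folklore]
[cite: Balaban1984PropagatorsI, (1.35) p.24] -/
theorem sum_le_sum_div_lsym_of_fibrewise (g : Tor (fine n M) → ℝ) (C : ℝ)
    (hzero : ∀ k : Fin d → Fin n, g (pOf n M (k, 0)) = 0)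
    (hfib : ∀ q : Tor M, q ≠ 0 →
      ∑ k : Fin d → Fin n, g (pOf n M (k, q)) ≤ C * ∑ k : Fin d → Fin n, g (pOf n M (k, q)) / ‖lsym (fine n M) (n : ℂ) (pOf n M (k, q))‖) :
    ∑ p, g p ≤ C * ∑ p, g p / ‖lsym (fine n M) (n : ℂ) p‖ := by
  rw [sum_pOf_fibres n M (fun p => g p), sum_pOf_fibres n M (fun p => g p / ‖lsym (fine n M) (n : ℂ) p‖),
    ← Finset.add_sum_erase _ _ (Finset.mem_univ (0 : Tor M)),
    ← Finset.add_sum_erase univ (fun q => ∑ k : Fin d → Fin n, g (pOf n M (k, q)) / ‖lsym (fine n M) (n : ℂ) (pOf n M (k, q))‖)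
      (Finset.mem_univ (0 : Tor M))]
  have h0a : ∑ k : Fin d → Fin n, g (pOf n M (k, 0)) = 0 := Finset.sum_eq_zero fun k _ => hzero k
  have h0b : ∑ k : Fin d → Fin n, g (pOf n M (k, 0)) / ‖lsym (fine n M) (n : ℂ) (pOf n M (k, 0))‖ = 0 :=
    Finset.sum_eq_zero fun k _ => by rw [hzero k, zero_div]
  rw [h0a, h0b, zero_add, zero_add, Finset.mul_sum]
  exact Finset.sum_le_sum fun q hq => hfib q (Finset.ne_of_mem_erase hq)

/-- ★★ **BOX–BOX–TENT FIBRES, one order up**: if `g` vanishes on the zero fibre and is a non-negative multiple of the box–box–tent weights on each other fibre, then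
`Σ_p g(p) ≤ C_B↑·Σ_p g(p)∕Δ(p)`, `C_B↑ = dπ²(1 + (π²∕4)^{d+1})`. [cite: Balaban1984PropagatorsI, (1.31)-(1.36) pp.23-24] -/
theorem sum_le_sum_div_lsym_of_tent_fibres (hn : 1 ≤ n) (μ : Fin d) (g : Tor (fine n M) → ℝ) (c : Tor M → ℝ) (hc : ∀ q, 0 ≤ c q)
    (hzero : ∀ k : Fin d → Fin n, g (pOf n M (k, 0)) = 0)
    (hg : ∀ q : Tor M, q ≠ 0 → ∀ k : Fin d → Fin n,
      g (pOf n M (k, q)) = c q * (Ur n k (sOf M q) * uFactorr n (k μ : ℕ) (sOf M q μ))) :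
    ∑ p, g p ≤ (d * Real.pi ^ 2 * (1 + (Real.pi ^ 2 / 4) ^ (d + 1))) * ∑ p, g p / ‖lsym (fine n M) (n : ℂ) p‖ := by
  refine sum_le_sum_div_lsym_of_fibrewise n M g _ hzero fun q hq => ?_
  have hs : ∀ ν, |sOf M q ν| ≤ Real.pi := abs_sOf_le M q
  have hs0 : sOf M q ≠ 0 := sOf_ne_zero M hq
  have hnorm : ∀ k : Fin d → Fin n, ‖lsym (fine n M) (n : ℂ) (pOf n M (k, q))‖ = DeltaXir n 0 (shiftr n k (sOf M q)) := fun k => by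
    rw [lsym_pOf, Complex.norm_real, Real.norm_of_nonneg (DeltaXir_nonneg n 0 le_rfl _)]
  simp_rw [hnorm, hg q hq]
  have h := alias_sum_tent_le_up n hn (sOf M q) hs hs0 μ
  have e1 : ∑ k : Fin d → Fin n, c q * (Ur n k (sOf M q) * uFactorr n (k μ : ℕ) (sOf M q μ))
      = c q * ∑ k : Fin d → Fin n, Ur n k (sOf M q) * uFactorr n (k μ : ℕ) (sOf M q μ) := by rw [Finset.mul_sum]
  have e2 : ∑ k : Fin d → Fin n, c q * (Ur n k (sOf M q) * uFactorr n (k μ : ℕ) (sOf M q μ)) / DeltaXir n 0 (shiftr n k (sOf M q))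
      = c q * ∑ k : Fin d → Fin n, Ur n k (sOf M q) * uFactorr n (k μ : ℕ) (sOf M q μ) / DeltaXir n 0 (shiftr n k (sOf M q)) := by
    rw [Finset.mul_sum]; exact Finset.sum_congr rfl fun k _ => by ring
  rw [e1, e2, mul_left_comm]
  exact mul_le_mul_of_nonneg_left h (hc q)

/-! ## §3 ★★★ Bernstein one order up for the adjoint straight average -/

open B5Adjoint176 in
/-- ★★★ **BERNSTEIN ONE ORDER UP, MOMENTUM FORM**: for `f = ((Q_k)ᴴB)_κ` with `Σ_yB(y,κ) = 0`, `Σ_p|f̂(p)|² ≤ C_B↑·Σ_p|f̂(p)|²∕Δ(p)`.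
[cite: Balaban1984PropagatorsI, (1.18) p.20, (1.31)-(1.36) pp.23-24, (1.76) p.30] -/
theorem bernstein_up_QvOp_adjoint (hn : 1 ≤ n) (B : Tor M × Fin d → ℂ) (κ : Fin d) (hB : ∑ y, B (y, κ) = 0) :
    ∑ p, ‖(dft (fine n M) *ᵥ comp (fine n M) ((QvOp n M)ᴴ *ᵥ B) κ) p‖ ^ 2
      ≤ (d * Real.pi ^ 2 * (1 + (Real.pi ^ 2 / 4) ^ (d + 1)))
          * ∑ p, ‖(dft (fine n M) *ᵥ comp (fine n M) ((QvOp n M)ᴴ *ᵥ B) κ) p‖ ^ 2 / ‖lsym (fine n M) (n : ℂ) p‖ := by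
  have hB0 : (dft M *ᵥ comp M B κ) 0 = 0 := by
    rw [dft_zero_apply]
    have : ∑ x, comp M B κ x = 0 := hB
    rw [this, mul_zero]
  refine sum_le_sum_div_lsym_of_tent_fibres n M hn κ (fun p => ‖(dft (fine n M) *ᵥ comp (fine n M) ((QvOp n M)ᴴ *ᵥ B) κ) p‖ ^ 2)
    (fun q => ‖(cQ n M : ℂ)‖ ^ 2 * ‖(dft M *ᵥ comp M B κ) q‖ ^ 2) (fun q => by positivity) (fun k => ?_) (fun q _ k => ?_)
  · show ‖(dft (fine n M) *ᵥ comp (fine n M) ((QvOp n M)ᴴ *ᵥ B) κ) (pOf n M (k, 0))‖ ^ 2 = 0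
    rw [dft_QvOp_adjoint, hB0, mul_zero, norm_zero, zero_pow two_ne_zero]
  · show ‖(dft (fine n M) *ᵥ comp (fine n M) ((QvOp n M)ᴴ *ᵥ B) κ) (pOf n M (k, q))‖ ^ 2
        = ‖(cQ n M : ℂ)‖ ^ 2 * ‖(dft M *ᵥ comp M B κ) q‖ ^ 2 * (Ur n k (sOf M q) * uFactorr n (k κ : ℕ) (sOf M q κ))
    have hs : ∀ ν, |sOf M q ν| ≤ Real.pi := abs_sOf_le M q
    rw [dft_QvOp_adjoint, norm_mul, norm_mul, mul_pow, mul_pow, Complex.norm_conj, norm_mul, mul_pow,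
      norm_uSym_sq n hn k (sOf M q) hs, norm_vSym_sq n hn k (sOf M q) κ (hs κ)]
    ring

/-- ★★★ **BERNSTEIN ONE ORDER UP, POSITION FORM** (η-units): for `f = ((Q_k)ᴴB)_κ` with `Σ_yB(y,κ) = 0`, `Σ_x‖f x‖² ≤ C_B↑·re⟪f, Δ⁻¹f⟫`.  Lattice reading
(`Δ_η = n²Δ_lattice`): for `u := Δ_lattice⁻¹f`, `ℓ²·‖Δu‖² ≤ C_B↑·‖∇u‖²` (`ℓ = n = L^k`) — the current `J = Δu`-type field of a curl-minimal interpolant is `ℓ⁻²`-dominated by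
its gradient energy: the flat leading order of the J-ROW★ at an R2-critical background. [cite: Balaban1984PropagatorsI, (1.18) p.20, Sect. C p.22, (1.35) p.24; Balaban1985Variational, Prop. 7 p.299] -/
theorem bernstein_up_QvOp_adjoint_pos (hn : 1 ≤ n) (B : Tor M × Fin d → ℂ) (κ : Fin d) (hB : ∑ y, B (y, κ) = 0) :
    ∑ x, ‖comp (fine n M) ((QvOp n M)ᴴ *ᵥ B) κ x‖ ^ 2
      ≤ (d * Real.pi ^ 2 * (1 + (Real.pi ^ 2 / 4) ^ (d + 1)))
          * (star (comp (fine n M) ((QvOp n M)ᴴ *ᵥ B) κ) ⬝ᵥ (LapSinv (fine n M) (n : ℂ) *ᵥ comp (fine n M) ((QvOp n M)ᴴ *ᵥ B) κ)).re := by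
  set f : Tor (fine n M) → ℂ := comp (fine n M) ((QvOp n M)ᴴ *ᵥ B) κ with hf
  have h := bernstein_up_QvOp_adjoint n M hn B κ hB
  rw [← Prop7BlockLandauDivFlat.sum_norm_sq_div_lsym_eq n M (n : ℂ) f, ← sum_norm_sq_dft n M f]
  exact h

end Torus

end Summit.QuantumFields.YangMills.Theorems.Prop7AliasSumBernsteinUp

end
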